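import Literature.MathematicalPhysics.QuantumFieldTheory.Balaban1983to89.B7Eq214General

/-!
# `Balaban1983to89.B7Eq213Remainder` — T. Bałaban, *Averaging operations for lattice gauge theories*, Commun. Math. Phys. **98**
(1985) 17–51 [Balaban1985Averaging], Sect. F p. 50 [PDF 34]: **the remainder `C′_j(u₁, λ, y)` DEFINED by (213), as a named object at
a general background `U₀`**, with (213) as an identity and (214) restated for it

statement-level skeleton of published theorems with citation tags; proofs where landed; nothing here is a claim about the Yang–Mills mass gap

PDF held: `paper:balaban1985-cmp98-averaging` (journal page = PDF page + 16); render
`pub-balaban/b2b-balaban-ref1/pages/1985-cmp98-averaging/1985-cmp98-averaging-p034-x2.png` (p. 50) read via the text layer and the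
verbatim quotations of `B7Eq214General` by the typing seat (unit `lit-balaban-r04`, gen 52).

CITATION HEADER / PRINT, verbatim (p. 50): "`Q′_j(u₁, λ) = (1/i) log ũ′ʲ, j ≤ k`, (208)" … "By (179) the function `Q′_j(u₁, λ)` is a
composition of one-step functions and from the above formula we can easily see that `Q′_j(u₁, λ, y) = Σ_{x∈Bʲ(y)}
L^{−jd}R(U₀(Γ^{(j)}_{y,x}))λ(x) + Σ_{l=0}^{j−1} O(C₅α₄2α₄Lˡη + α₃2α₄(Lˡη)² + 4α₄²(Lˡη)²)`, (212) hence
`Q′_j(u₁, λ, y) = (Q′_jλ)(y) + C′_j(u₁, λ, y)`, (213)  `|C′_j(u₁, λ, y)| = O((α₃α₄ + α₄²)Lʲη)`. (214)"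

DICTIONARY (the b07 lineage's concrete model: `Ω ↦ ℤᵈ = Site d`, `G ↦` units of a complete normed `ℂ`-algebra `𝔸`, the `i`'s
absorbed).  `ũ′ʲ = B7Prop10General.utilG L U₀ u′ u₁ j` ((178)–(179)); `Q′_j(u₁, λ, y) = (1/i) log ũ′ʲ(y) ↦ mlog (utilG … j y)`
(208); `λ = (1/i) log u′ ↦ fun x => mlog (u′ x)`; `(Q′_jλ)(y) ↦ B7Eq214General.lamAvgG L U₀ j λ y` ((212), the linear operator);
**`C′_j(u₁, λ, y) ↦ Cprime L U₀ u′ u₁ j y`** (THIS FILE).  Hitherto `C′_j` was the unnamed difference inside the statement of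
`B7Eq214General.eq214_general` (and the abstract field `B7Eq214.GaugeLinData.remDev`); ROWS-B7 row `B7.Eq212` ((212)–(213), the
operator and the remainder) asked for it by name (owner audit gen 52, head question Q-B7-52-2).

WHAT THIS FILE ADDS (kernel, 0 sorry, standard axioms; ONE definition with print's body, no `def … : Prop`).
* **`Cprime L U₀ u′ u₁ j y := log ũ′ʲ(y) − (Q′_jλ)(y)`** — (213) solved for `C′_j`, i.e. (213) read as the DEFINITION of the remainder.
* **`eq213`** — (213) verbatim: `Q′_j(u₁, λ, y) = (Q′_jλ)(y) + C′_j(u₁, λ, y)`.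
* **`eq214_Cprime`** — (214) for the named remainder: `‖C′_j(u₁, λ, y)‖ ≤ C′_gen(α₃α₄ + α₄²)Lʲη` for all `j ≤ k`, `y`, under the
  hypotheses of `B7Eq214General.eq214_general` (restated verbatim; `C′_gen = B7Eq214General.Cgen d`).
* `Cprime_zero` (`C′_0 = 0`: at level `0`, `ũ′⁰ = u′` and `Q′_0λ = λ`).
Unit `lit-balaban-r04` gen 52, 2026-08-23.
-/

noncomputable section

open scoped BigOperators
open NormedSpace Finset

namespace Literature.MathematicalPhysics.QuantumFieldTheory.Balaban1983to89.B7Eq213Remainder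

open B7Prop1Explicit B7Prop2Explicit MatrixLog B7Eq167Flat B7Prop9Flat B7Prop9General B7Prop10General B7Eq214General

-- `Site` alone would resolve to the torus sites of `Setup.lean`; re-export the `ℤ^d` sites of `B7Prop1Explicit`.
export B7Prop1Explicit (Site)

variable {d : ℕ}
variable {𝔸 : Type*} [NormedRing 𝔸] [NormOneClass 𝔸] [NormedAlgebra ℂ 𝔸] [CompleteSpace 𝔸]

/-- **`C′_j(u₁, λ, y)`, the remainder of (213)**: `C′_j(u₁, λ, y) := Q′_j(u₁, λ, y) − (Q′_jλ)(y) = log ũ′ʲ(y) − (Q′_jλ)(y)` with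
`λ = log u′` ((208): `Q′_j(u₁, λ) = (1/i) log ũ′ʲ`; the `i`'s absorbed), at a general background `U₀`.
[cite: Balaban1985Averaging, (213) p.50, (208) p.50] -/
def Cprime (L : ℕ) (U₀ : Site d → Fin d → 𝔸ˣ) (u' u₁ : Site d → 𝔸ˣ) (j : ℕ) (y : Site d) : 𝔸 :=
  mlog ((utilG L U₀ u' u₁ j y : 𝔸ˣ) : 𝔸) - lamAvgG L U₀ j (fun x => mlog ((u' x : 𝔸ˣ) : 𝔸)) y

omit [NormOneClass 𝔸] in
/-- **(213)** verbatim: "`Q′_j(u₁, λ, y) = (Q′_jλ)(y) + C′_j(u₁, λ, y)`" — `log ũ′ʲ(y) = (Q′_jλ)(y) + C′_j(u₁, λ, y)`, `λ = log u′`.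
[cite: Balaban1985Averaging, (213) p.50] -/
theorem eq213 (L : ℕ) (U₀ : Site d → Fin d → 𝔸ˣ) (u' u₁ : Site d → 𝔸ˣ) (j : ℕ) (y : Site d) :
    mlog ((utilG L U₀ u' u₁ j y : 𝔸ˣ) : 𝔸)
      = lamAvgG L U₀ j (fun x => mlog ((u' x : 𝔸ˣ) : 𝔸)) y + Cprime L U₀ u' u₁ j y := by
  rw [Cprime, add_sub_cancel]

omit [NormOneClass 𝔸] in
/-- At level `0` the remainder vanishes: `ũ′⁰ = u′` ((179), `utilG_zero`) and `Q′₀λ = λ` (`lamAvgG_zero`). [cite: Balaban1985Averaging, (213) p.50, (179) p.45] -/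
theorem Cprime_zero (L : ℕ) (U₀ : Site d → Fin d → 𝔸ˣ) (u' u₁ : Site d → 𝔸ˣ) (y : Site d) :
    Cprime L U₀ u' u₁ 0 y = 0 := by
  simp [Cprime, utilG_zero]

variable {L : ℕ} {U₀ : Site d → Fin d → 𝔸ˣ} {k : ℕ} {u' u₁ : Site d → 𝔸ˣ} {α₀ α₃ α₄ η : ℝ}

/-- **(214) for the named remainder**: "`|C′_j(u₁, λ, y)| = O((α₃α₄ + α₄²)Lʲη)`" — `‖C′_j(u₁, λ, y)‖ ≤ C′_gen·(α₃α₄ + α₄²)·Lʲη` for all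
`j ≤ k` and all `y`, with `C′_gen = B7Eq214General.Cgen d = 8832(d+1)C₆`, under the hypotheses of `B7Eq214General.eq214_general`
(the level hypotheses `Ū₀ʲ ∈ U1`, `‖Ū₀ʲ(∂p) − 1‖ ≤ 2α₀(Lʲη)²` for `j < k`; (176) `SiteBd u′ α₄`; (177) `CovBondBd U₀ u′ (α₄η)`;
(166)–(167) `u₁ ∈ Λ_k(U₀, α₃)`; `L ≥ 2`, `0 ≤ η`, `Lᵏη ≤ 1`; the explicit smallness of that theorem). [cite: Balaban1985Averaging, (214) p.50, (213) p.50] -/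
theorem eq214_Cprime (hL : 2 ≤ L)
    (hV : ∀ j < k, ∀ (x : Site d) (κ : Fin d), avgIter L U₀ j x κ ∈ U1 𝔸)
    (h52 : ∀ j < k, ∀ (x : Site d) (κ μ : Fin d), κ ≠ μ →
      ‖((hol (avgIter L U₀ j) x (plaqWord κ μ) : 𝔸ˣ) : 𝔸) - 1‖ ≤ 2 * α₀ * ((L : ℝ) ^ j * η) ^ 2)
    (h176 : SiteBd u' α₄) (h177 : CovBondBd U₀ u' (α₄ * η)) (hu₁ : InLambda L U₀ u₁ k α₃ η)
    (hη : 0 ≤ η) (hk : (L : ℝ) ^ k * η ≤ 1) (hα₀ : 0 ≤ α₀) (hα₃ : 0 ≤ α₃) (hα₃' : α₃ ≤ 1 / 200) (hα₄ : 0 ≤ α₄)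
    (hs₁ : 50 * C6 d * α₄ ≤ 1) (hs₂ : 3000 * ((d : ℝ) + 1) * L * α₄ ≤ 1) (hs₃ : C4G d L * (α₀ + α₃ + α₄) ≤ 1)
    (hs₄ : 1024 * ((d : ℝ) + 1) * ((d : ℝ) + 4) * L ^ 2 * α₀ ≤ 1) (hs₅ : 32 * ((d : ℝ) + 1) ^ 2 * C6 d * L ^ 2 * α₀ ≤ 1)
    (hs₆ : 16 * d * C5' d * C6 d * (L : ℝ) ^ 2 * α₀ ≤ 1) (hs₇ : 8 * d * C6 d * L * α₀ ≤ 1) :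
    ∀ j ≤ k, ∀ y : Site d, ‖Cprime L U₀ u' u₁ j y‖ ≤ Cgen d * (α₃ * α₄ + α₄ ^ 2) * ((L : ℝ) ^ j * η) :=
  eq214_general hL hV h52 h176 h177 hu₁ hη hk hα₀ hα₃ hα₃' hα₄ hs₁ hs₂ hs₃ hs₄ hs₅ hs₆ hs₇

end Literature.MathematicalPhysics.QuantumFieldTheory.Balaban1983to89.B7Eq213Remainder
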